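import Summits.Ventures.CertifiedManyBodySolver.Transport.ChainWindowSpinRotationRows
import HarnessLib

/-!
# Ventures/CertifiedManyBodySolver — Transport/ChainWindowSpinRotationRowsNszb.lean

Speedrun cell sr-mbsolver / programme hubbard-alg — LIT team (lit-1 gen-18): the window-level transport for the `jw-srot` rows WITH
STAGGERED-SPIN SECTORS (FORMAT-ksdn v0.6 'staggered charge components', the `nszb` tensors of CERTIFIED #355 / #381 / #399 / #405 /
#430 / #436 / #437 / #443). Theorem-only.
HONEST FRAMING: first certified bounds; not a superconductivity verdict; every number certified or labelled float.

WHAT THIS GIVES. `ksdnClaim_of_srotClaim` (`Transport/ChainWindowSpinRotationRows.lean`) proves that the `jw-srot` window statement —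
quantified over window variables `ρ'` with TOTAL-OCCUPATION sector zeros only — implies the standard window statement (the `hclaim` of
`Rows.LTIChainKSDNNode`, `(N↑, N↓)` sectors). Its proof evaluates the `jw-srot` statement at `ρ₂ = V ρ₁ Vᴴ`, `ρ₁ = ½(ρ + FρFᴴ)` the
spin-flip midpoint of an `(N↑, N↓)`-sectored `ρ`, `V = ⨂_x v_x` the odd-site spin flips. This file records the one extra fact the
`nszb` rows need: `V` carries the physical magnetisation `N↑ − N↓` to the STAGGERED spin count
`Σ_y ε_y ([↑ ∈ occ k_y] − [↓ ∈ occ k_y])`, `ε_y = −1` on odd sites and `+1` on even sites (`stagCount_spinRot`), so `ρ₂` is in addition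
block diagonal in that staggered count (`spinRot_staggeredSectorRow`) — in the `jw-srot` frame the conserved spin charge IS staggered
(Essler et al. §12.3.4: the sublattice rotation maps `S^z_tot` to the staggered magnetisation). Hence **`ksdnClaim_of_srotNszbClaim`**: the
WEAKER `jw-srot` window statement whose window variables are assumed block diagonal in the total occupation AND in the staggered spin
count still implies the standard window statement. This is the soundness of the relaxations with staggered charge components at the
window level, with no twirling argument: the extra sector zeros are inherited from the `(N↑, N↓)` sectors of the standard node.
Nothing is asserted; no definition, no `sorry`, no new axiom, no named fact.
[cite: KullEtAl2024, §II.B eq. (locTIn), §3.3, §VI.B] [cite: EsslerEtAl2005, §12.3.4 eqs. (12.196)–(12.201)]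
-/

noncomputable section

open Matrix Complex
open scoped ComplexOrder BigOperators
open Literature.Probability.LatticeModels
open Literature.MathematicalPhysics.QuantumLattice
open Literature.MathematicalPhysics.QuantumLattice.HubbardWave0
open Literature.MathematicalPhysics.QuantumLattice.JordanWigner

namespace Summit.Ventures.CertifiedManyBodySolver.Transport

/-! ### §7 The staggered spin count under `V` -/

section Staggered

variable {Λ : Finset (Site 1)}

/-- One site: the spin count `[↑ ∈ occ a] − [↓ ∈ occ a]` of the swapped state is minus that of `a`. [folklore] -/
theorem twoSzCount_swap (a : Fin 4) :
    ((if (0 : Fin 2) ∈ siteOcc ((![0, 2, 1, 3] : Fin 4 → Fin 4) a) then 1 else 0 : ℤ) -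
        (if (1 : Fin 2) ∈ siteOcc ((![0, 2, 1, 3] : Fin 4 → Fin 4) a) then 1 else 0 : ℤ)) =
      -((if (0 : Fin 2) ∈ siteOcc a then 1 else 0 : ℤ) - (if (1 : Fin 2) ∈ siteOcc a then 1 else 0 : ℤ)) := by
  fin_cases a <;> simp [siteOcc]

/-- **`V` carries the magnetisation to the STAGGERED spin count**: for the configuration map `p` of `V = ⨂_x v_x` (swap `↑ ↔ ↓` on the odd
sites), `N↑(p k) − N↓(p k) = Σ_y ε_y ([↑ ∈ occ k_y] − [↓ ∈ occ k_y])` with `ε_y = −1` on odd and `+1` on even sites.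
[cite: EsslerEtAl2005, §12.3.4 eqs. (12.196)–(12.201)] -/
theorem stagCount_spinRot (k : TensorIndex (PolySite Λ) 4) :
    ((∑ y : PolySite Λ, (if (0 : Fin 2) ∈ siteOcc (if Odd (ofLex y.1 0) then (![0, 2, 1, 3] : Fin 4 → Fin 4) (k y) else k y)
        then 1 else 0 : ℕ)) : ℤ) -
      ((∑ y : PolySite Λ, (if (1 : Fin 2) ∈ siteOcc (if Odd (ofLex y.1 0) then (![0, 2, 1, 3] : Fin 4 → Fin 4) (k y) else k y)
        then 1 else 0 : ℕ)) : ℤ) =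
      ∑ y : PolySite Λ, (if Odd (ofLex y.1 0) then (-1 : ℤ) else 1) *
        ((if (0 : Fin 2) ∈ siteOcc (k y) then 1 else 0 : ℤ) - (if (1 : Fin 2) ∈ siteOcc (k y) then 1 else 0 : ℤ)) := by
  push_cast
  rw [← Finset.sum_sub_distrib]
  refine Finset.sum_congr rfl fun y _ => ?_
  by_cases h : Odd (ofLex y.1 0)
  · rw [if_pos h, if_pos h, twoSzCount_swap, neg_one_mul]
  · rw [if_neg h, if_neg h, one_mul]

/-- **Staggered-spin sector zeros of `V ρ Vᴴ` from the `(N↑, N↓)` sectors of `ρ`.** If `ρ` vanishes between configurations with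
different `N↑` or different `N↓`, then `V ρ Vᴴ` vanishes between configurations with different staggered spin count
`Σ_y ε_y ([↑ ∈ occ k_y] − [↓ ∈ occ k_y])`. [cite: EsslerEtAl2005, §12.3.4] [cite: KullEtAl2024, §3.3] -/
theorem spinRot_staggeredSectorRow {ρ : Op (PolySite Λ) 4}
    (hρ : ∀ σ : Fin 2, ∀ k k' : TensorIndex (PolySite Λ) 4,
      (∑ x, if σ ∈ siteOcc (k x) then 1 else 0 : ℕ) ≠ (∑ x, if σ ∈ siteOcc (k' x) then 1 else 0 : ℕ) → ρ k k' = 0)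
    (k k' : TensorIndex (PolySite Λ) 4)
    (hk : (∑ y : PolySite Λ, (if Odd (ofLex y.1 0) then (-1 : ℤ) else 1) *
        ((if (0 : Fin 2) ∈ siteOcc (k y) then 1 else 0 : ℤ) - (if (1 : Fin 2) ∈ siteOcc (k y) then 1 else 0 : ℤ))) ≠
      (∑ y : PolySite Λ, (if Odd (ofLex y.1 0) then (-1 : ℤ) else 1) *
        ((if (0 : Fin 2) ∈ siteOcc (k' y) then 1 else 0 : ℤ) - (if (1 : Fin 2) ∈ siteOcc (k' y) then 1 else 0 : ℤ)))) :
    (productOp (oddSiteSpinFlip (Λ := Λ)) * ρ * (productOp oddSiteSpinFlip)ᴴ : Op (PolySite Λ) 4) k k' = 0 := by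
  rw [signedPerm_conj_apply _ _ spinRot_apply]
  suffices h : ρ (fun y : PolySite Λ => if Odd (ofLex y.1 0) then (![0, 2, 1, 3] : Fin 4 → Fin 4) (k y) else k y)
      (fun y : PolySite Λ => if Odd (ofLex y.1 0) then (![0, 2, 1, 3] : Fin 4 → Fin 4) (k' y) else k' y) = 0 by
    rw [h, mul_zero]
  by_contra hne
  apply hk
  have hσ : ∀ σ : Fin 2,
      (∑ x : PolySite Λ, if σ ∈ siteOcc (if Odd (ofLex x.1 0) then (![0, 2, 1, 3] : Fin 4 → Fin 4) (k x) else k x)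
        then 1 else 0 : ℕ) =
      ∑ x : PolySite Λ, if σ ∈ siteOcc (if Odd (ofLex x.1 0) then (![0, 2, 1, 3] : Fin 4 → Fin 4) (k' x) else k' x)
        then 1 else 0 := by
    intro σ
    by_contra h
    exact hne (hρ σ _ _ h)
  have hσ' : ∀ σ : Fin 2,
      (∑ x : PolySite Λ, ((if σ ∈ siteOcc (if Odd (ofLex x.1 0) then (![0, 2, 1, 3] : Fin 4 → Fin 4) (k x) else k x)
        then 1 else 0 : ℕ) : ℤ)) =
      ∑ x : PolySite Λ, ((if σ ∈ siteOcc (if Odd (ofLex x.1 0) then (![0, 2, 1, 3] : Fin 4 → Fin 4) (k' x) else k' x)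
        then 1 else 0 : ℕ) : ℤ) := fun σ => by exact_mod_cast hσ σ
  rw [← stagCount_spinRot k, ← stagCount_spinRot k', hσ' 0, hσ' 1]

end Staggered


/-! ### §8 The `jw-srot` window statement with staggered-spin sectors implies the standard window statement -/

section TransportNszb

/-- **`ksdnClaim_of_srotNszbClaim`: the `jw-srot` window statement WITH STAGGERED-SPIN SECTOR ZEROS implies the standard window
statement.** HYPOTHESIS `hclaim`: for every window variable `ρ' : Op (PolySite {-1, …, n+1}) 4` — `ρ' ⪰ 0`, `tr ρ' = 1`, local translation
invariance, TOTAL-OCCUPATION sector zeros, STAGGERED-SPIN sector zeros (`ρ'_{kk'} = 0` unless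
`Σ_y ε_y ([↑ ∈ occ k_y] − [↓ ∈ occ k_y])` agree, `ε_y = −1` on odd / `+1` on even sites — the second, staggered charge component of the
`nszb` tensors, FORMAT-ksdn v0.6), total density of site `-1` equal to `ν`, real entries, `|ρ'| ≤ 1` — the `jw-srot` bond bound
`E ≤ Re tr(toSpin(U n_{-1↑}n_{-1↓} − t Σ_σ (c†_{-1σ} c_{0σ̄} + c†_{0σ̄} c_{-1σ})) ρ')`. CONCLUSION: the `hclaim` of
`lti_primal_chainWindow_energyDensity[At]_ge_ksdn` (standard form, `(N↑, N↓)` sectors) — literally the conclusion of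
`ksdnClaim_of_srotClaim`. Proof: as there (spin-flip midpoint `ρ₁`, then `ρ₂ = V ρ₁ Vᴴ`), plus `spinRot_staggeredSectorRow`: `ρ₂` is
staggered-sectored because `ρ₁` is `(N↑, N↓)`-sectored. [cite: KullEtAl2024, §II.B eq. (locTIn), §3.3, §VI.B]
[cite: EsslerEtAl2005, §12.3.4 eqs. (12.196)–(12.201)] -/
theorem ksdnClaim_of_srotNszbClaim (t U : ℝ) (n : ℕ) {ν E : ℝ}
    (hclaim : ∀ ρ : Op (PolySite (chainWindow (-1) ((n : ℤ) + 1))) 4, ρ.PosSemidef → ρ.trace = 1 →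
      spinPartialTrace ((PolySite.affEmb 1 (unitVec 0) (chainWindow (-1) (n : ℤ))).trans
          (PolySite.incl (affShiftSet_chainWindow_subset (-1) (n : ℤ)))) ρ =
        spinPartialTrace (PolySite.incl (chainWindow_mono_right (-1) (by omega : (n : ℤ) ≤ n + 1))) ρ →
      (∀ k k' : TensorIndex (PolySite (chainWindow (-1) ((n : ℤ) + 1))) 4,
        (∑ x, (siteOcc (k x)).card) ≠ (∑ x, (siteOcc (k' x)).card) → ρ k k' = 0) →
      (∀ k k' : TensorIndex (PolySite (chainWindow (-1) ((n : ℤ) + 1))) 4,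
        (∑ y : PolySite (chainWindow (-1) ((n : ℤ) + 1)), (if Odd (ofLex y.1 0) then (-1 : ℤ) else 1) *
            ((if (0 : Fin 2) ∈ siteOcc (k y) then 1 else 0 : ℤ) - (if (1 : Fin 2) ∈ siteOcc (k y) then 1 else 0 : ℤ))) ≠
          (∑ y : PolySite (chainWindow (-1) ((n : ℤ) + 1)), (if Odd (ofLex y.1 0) then (-1 : ℤ) else 1) *
            ((if (0 : Fin 2) ∈ siteOcc (k' y) then 1 else 0 : ℤ) - (if (1 : Fin 2) ∈ siteOcc (k' y) then 1 else 0 : ℤ))) →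
        ρ k k' = 0) →
      ((toSpin (nAt (-unitVec 0) (neg_unitVec_mem_chainWindow (by omega : (-1 : ℤ) ≤ n + 1)) 0 +
          nAt (-unitVec 0) (neg_unitVec_mem_chainWindow (by omega : (-1 : ℤ) ≤ n + 1)) 1) * ρ).trace).re = ν →
      (∀ k k' : TensorIndex (PolySite (chainWindow (-1) ((n : ℤ) + 1))) 4, starRingEnd ℂ (ρ k k') = ρ k k') →
      (∀ k k' : TensorIndex (PolySite (chainWindow (-1) ((n : ℤ) + 1))) 4, ‖ρ k k'‖ ≤ 1) →
      E ≤ ((toSpin ((U : ℂ) • (nAt (-unitVec 0) (neg_unitVec_mem_chainWindow (by omega : (-1 : ℤ) ≤ n + 1)) 0 *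
            nAt (-unitVec 0) (neg_unitVec_mem_chainWindow (by omega : (-1 : ℤ) ≤ n + 1)) 1) +
          (-(t : ℂ)) • ∑ σ : Fin 2,
            ((cAt (-unitVec 0) (neg_unitVec_mem_chainWindow (by omega : (-1 : ℤ) ≤ n + 1)) σ)ᴴ *
                cAt 0 (zero_mem_chainWindow (by omega : (0 : ℤ) ≤ n + 1)) σ.rev +
              (cAt 0 (zero_mem_chainWindow (by omega : (0 : ℤ) ≤ n + 1)) σ.rev)ᴴ *
                cAt (-unitVec 0) (neg_unitVec_mem_chainWindow (by omega : (-1 : ℤ) ≤ n + 1)) σ)) * ρ).trace).re) :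
    ∀ ρ : Op (PolySite (chainWindow (-1) ((n : ℤ) + 1))) 4, ρ.PosSemidef → ρ.trace = 1 →
      spinPartialTrace ((PolySite.affEmb 1 (unitVec 0) (chainWindow (-1) (n : ℤ))).trans
          (PolySite.incl (affShiftSet_chainWindow_subset (-1) (n : ℤ)))) ρ =
        spinPartialTrace (PolySite.incl (chainWindow_mono_right (-1) (by omega : (n : ℤ) ≤ n + 1))) ρ →
      (∀ σ : Fin 2, ∀ k k' : TensorIndex (PolySite (chainWindow (-1) ((n : ℤ) + 1))) 4,
        (∑ x, if σ ∈ siteOcc (k x) then 1 else 0 : ℕ) ≠ (∑ x, if σ ∈ siteOcc (k' x) then 1 else 0 : ℕ) → ρ k k' = 0) →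
      ((toSpin (nAt (-unitVec 0) (neg_unitVec_mem_chainWindow (by omega : (-1 : ℤ) ≤ n + 1)) 0 +
          nAt (-unitVec 0) (neg_unitVec_mem_chainWindow (by omega : (-1 : ℤ) ≤ n + 1)) 1) * ρ).trace).re = ν →
      (∀ k k' : TensorIndex (PolySite (chainWindow (-1) ((n : ℤ) + 1))) 4, starRingEnd ℂ (ρ k k') = ρ k k') →
      (∀ k k' : TensorIndex (PolySite (chainWindow (-1) ((n : ℤ) + 1))) 4, ‖ρ k k'‖ ≤ 1) →
      E ≤ ((toSpin ((U : ℂ) • (nAt (-unitVec 0) (neg_unitVec_mem_chainWindow (by omega : (-1 : ℤ) ≤ n + 1)) 0 *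
            nAt (-unitVec 0) (neg_unitVec_mem_chainWindow (by omega : (-1 : ℤ) ≤ n + 1)) 1) +
          (-(t : ℂ)) • ∑ σ : Fin 2,
            ((cAt (-unitVec 0) (neg_unitVec_mem_chainWindow (by omega : (-1 : ℤ) ≤ n + 1)) σ)ᴴ *
                cAt 0 (zero_mem_chainWindow (by omega : (0 : ℤ) ≤ n + 1)) σ +
              (cAt 0 (zero_mem_chainWindow (by omega : (0 : ℤ) ≤ n + 1)) σ)ᴴ *
                cAt (-unitVec 0) (neg_unitVec_mem_chainWindow (by omega : (-1 : ℤ) ≤ n + 1)) σ)) * ρ).trace).re := by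
  intro ρ hpos htr hlti hsec hdens hreal _
  -- Step 1: the spin-flip midpoint `ρ₁ = ½(ρ + F ρ Fᴴ)`
  set F : Op (PolySite (chainWindow (-1) ((n : ℤ) + 1))) 4 := productOp (fun _ => uSpinFlip)
  have hFF : Fᴴ * F = 1 := spinFlip_conjTranspose_mul_self
  have pos' : (F * ρ * Fᴴ).PosSemidef := conj_posSemidef F hpos
  have tr' : (F * ρ * Fᴴ).trace = 1 := by rw [conj_trace hFF]; exact htr
  have lti' := spinFlip_ltiRow n hlti
  have sec' := fun σ k k' hk => spinFlip_sectorRow hsec σ k k' hk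
  have dens' := spinFlip_ksdnDensityRow n hdens
  have real' := fun k k' => spinFlip_realRow hreal k k'
  set ρ₁ : Op (PolySite (chainWindow (-1) ((n : ℤ) + 1))) 4 := (2 : ℂ)⁻¹ • (ρ + F * ρ * Fᴴ)
  have pos₁ : ρ₁.PosSemidef := posSemidef_midpoint hpos pos'
  have tr₁ : ρ₁.trace = 1 := trace_midpoint htr tr'
  have lti₁ : spinPartialTrace ((PolySite.affEmb 1 (unitVec 0) (chainWindow (-1) (n : ℤ))).trans
        (PolySite.incl (affShiftSet_chainWindow_subset (-1) (n : ℤ)))) ρ₁ =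
      spinPartialTrace (PolySite.incl (chainWindow_mono_right (-1) (by omega : (n : ℤ) ≤ n + 1))) ρ₁ :=
    linearRow_midpoint _ _ hlti lti'
  have sec₁ : ∀ σ : Fin 2, ∀ k k' : TensorIndex (PolySite (chainWindow (-1) ((n : ℤ) + 1))) 4,
      (∑ x, if σ ∈ siteOcc (k x) then 1 else 0 : ℕ) ≠ (∑ x, if σ ∈ siteOcc (k' x) then 1 else 0 : ℕ) → ρ₁ k k' = 0 :=
    fun σ k k' hk => apply_midpoint_eq_zero (hsec σ k k' hk) (sec' σ k k' hk)
  have dens₁ := re_trace_mul_midpoint _ hdens dens'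
  have real₁ : ∀ k k', starRingEnd ℂ (ρ₁ k k') = ρ₁ k k' := fun k k' => conj_apply_midpoint hreal real' k k'
  have inv₁ : F * ρ₁ * Fᴴ = ρ₁ := conj_midpoint_self F ρ (spinFlip_sq_conj ρ)
  have obj₁ := re_trace_mul_midpoint _ rfl (spinFlip_ksdnObjective n t U ρ)
  -- Step 2: conjugation by the staggered product `V = ⨂_x v_x`
  set V : Op (PolySite (chainWindow (-1) ((n : ℤ) + 1))) 4 := productOp oddSiteSpinFlip
  have hVV : Vᴴ * V = 1 := spinRot_conjTranspose_mul_self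
  have pos₂ : (V * ρ₁ * Vᴴ).PosSemidef := conj_posSemidef V pos₁
  have tr₂ : (V * ρ₁ * Vᴴ).trace = 1 := by rw [conj_trace hVV]; exact tr₁
  have lti₂ := spinRot_ltiRow n lti₁ inv₁
  have sec₂ : ∀ k k' : TensorIndex (PolySite (chainWindow (-1) ((n : ℤ) + 1))) 4,
      (∑ x, (siteOcc (k x)).card) ≠ (∑ x, (siteOcc (k' x)).card) → (V * ρ₁ * Vᴴ) k k' = 0 :=
    fun k k' hk => spinRot_sectorRow (fun l l' hl => totSectorRow_of_sectorRow sec₁ l l' hl) k k' hk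
  -- the extra row of the `nszb` relaxations: staggered-spin sectors of `V ρ₁ Vᴴ` from the `(N↑, N↓)` sectors of `ρ₁`
  have stag₂ : ∀ k k' : TensorIndex (PolySite (chainWindow (-1) ((n : ℤ) + 1))) 4,
      (∑ y : PolySite (chainWindow (-1) ((n : ℤ) + 1)), (if Odd (ofLex y.1 0) then (-1 : ℤ) else 1) *
          ((if (0 : Fin 2) ∈ siteOcc (k y) then 1 else 0 : ℤ) - (if (1 : Fin 2) ∈ siteOcc (k y) then 1 else 0 : ℤ))) ≠
        (∑ y : PolySite (chainWindow (-1) ((n : ℤ) + 1)), (if Odd (ofLex y.1 0) then (-1 : ℤ) else 1) *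
          ((if (0 : Fin 2) ∈ siteOcc (k' y) then 1 else 0 : ℤ) - (if (1 : Fin 2) ∈ siteOcc (k' y) then 1 else 0 : ℤ))) →
      (V * ρ₁ * Vᴴ) k k' = 0 :=
    fun k k' hk => spinRot_staggeredSectorRow sec₁ k k' hk
  have dens₂ := spinRot_ksdnDensityRow n dens₁
  have real₂ : ∀ k k', starRingEnd ℂ ((V * ρ₁ * Vᴴ) k k') = (V * ρ₁ * Vᴴ) k k' := fun k k' => spinRot_realRow real₁ k k'
  have norm₂ : ∀ k k', ‖(V * ρ₁ * Vᴴ) k k'‖ ≤ 1 := norm_apply_le_one_of_posSemidef pos₂ tr₂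
  -- Step 3: the `jw-srot` bound at `V ρ₁ Vᴴ` is the standard bound at `ρ`
  have key := hclaim (V * ρ₁ * Vᴴ) pos₂ tr₂ lti₂ sec₂ stag₂ dens₂ real₂ norm₂
  exact key.trans_eq ((spinRot_srotObjective n t U ρ₁).trans obj₁)

end TransportNszb

end Summit.Ventures.CertifiedManyBodySolver.Transport

end
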